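import Summits.ValiantsHypothesis.ValiantsHypothesis.Theorems.DivisionGapZeroOneTransferStubFormulaGridProjectionAux4

/-!
# Crux `DivisionGap.ZeroOneTransfer` (stmt-ValiantsHypothesis-5066), line `planar-dimer-sign-elimination` —
stub `stub_formulaGridProjection`, support file 5: SERIES composition in the square grid

Two grid gadgets (file 4: `Gad⟦W, r, c, h, w, g⟧`) placed side by side with their top rows
aligned, joined by one unit connector edge between the top-right port of the first and the
top-left port of the second, the space below the shorter one tiled by horizontal unit dominoes,
form a grid gadget for the PRODUCT on the `max hF hG × (wF + wG)` rectangle (`gad_series`: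
`twoState_series` of file 2 + `gad_fill` of file 4; Valiant 1979 §2, series composition).

Registered sub-goal proved here: `stub_formulaGridProjection_seriesGadget` (the same statement with
the notation expanded). [folklore]
-/

set_option linter.dupNamespace false

namespace Summit.ValiantsHypothesis.ValiantsHypothesis.Theorems.DivisionGapZeroOneTransfer

namespace FormulaGridProjection

open Finset MvPolynomial

/-- `TwoState⟦D, W, p, q, g⟧` (a LOCAL NOTATION, deliberately not a definition): a TWO-STATE GADGET on the
vertex set `D` with ports `p ≠ q` computing `g` — the whole of `D` has matching sum `g` ("active": both
ports matched inside), `D ∖ {p, q}` has matching sum `1` ("inactive"), and `|D|` is even (so the two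
mixed states have matching sum `0` by parity).  The two-attachment case of a gadget signature
(Valiant 1979 §2; DKLM 2010 §4.4). -/
local notation3 "TwoState⟦" D ", " W ", " p ", " q ", " g "⟧" =>
  p ∈ D ∧ q ∈ D ∧ p ≠ q ∧ Even (Finset.card D) ∧ msum D W = g ∧
    msum (Finset.erase (Finset.erase D p) q) W = 1


/-- `IsLab⟦x⟧` (local notation): `x` is literally a variable `X j` or a constant `C c` — the entries
allowed in a Valiant projection (`IsProjection`). -/
local notation3 "IsLab⟦" x "⟧" => (∃ j, x = MvPolynomial.X j) ∨ ∃ c, x = MvPolynomial.C c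

/-- `Adj⟦a, b⟧` (local notation): adjacency of the square grid on `ℕ × ℕ`, verbatim the four disjuncts
of the route's grid-dimer polynomial. -/
local notation3 "Adj⟦" a ", " b "⟧" =>
  (Prod.fst a + 1 = Prod.fst b ∧ Prod.snd a = Prod.snd b) ∨
    (Prod.fst b + 1 = Prod.fst a ∧ Prod.snd a = Prod.snd b) ∨
    (Prod.fst a = Prod.fst b ∧ Prod.snd a + 1 = Prod.snd b) ∨
    (Prod.fst a = Prod.fst b ∧ Prod.snd b + 1 = Prod.snd a)

/-- `box⟦r, c, h, w⟧` (local notation): the `h × w` rectangle of cells with top-left cell `(r, c)`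
(rows `r ≤ i < r + h`, columns `c ≤ j < c + w`). -/
local notation3 "box⟦" r ", " c ", " h ", " w "⟧" =>
  (Finset.Ico r (r + h) ×ˢ Finset.Ico c (c + w) : Finset (ℕ × ℕ))

/-- `Gad⟦W, r, c, h, w, g⟧` (local notation): `W` is a GRID GADGET for `g` on the rectangle
`box⟦r, c, h, w⟧` — every dart weight is a label, non-zero weights only on darts between adjacent
cells of the rectangle, and the rectangle is a two-state gadget computing `g` with ports its
top-left and top-right cells. -/
local notation3 "Gad⟦" W ", " r ", " c ", " h ", " w ", " g "⟧" =>
  (∀ a b, IsLab⟦W a b⟧) ∧ (∀ a b, W a b ≠ 0 → a ∈ box⟦r, c, h, w⟧ ∧ b ∈ box⟦r, c, h, w⟧ ∧ Adj⟦a, b⟧) ∧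
    TwoState⟦box⟦r, c, h, w⟧, W, (r, c), (r, c + w - 1), g⟧

section Grid2

variable {R : Type*} [CommSemiring R] {ι : Type*}

/-- **Series in the grid.** Two grid gadgets side by side with their top rows aligned, joined by a
unit connector edge between the top-right port of the first and the top-left port of the second,
the space below the shorter one tiled by horizontal unit dominoes: a grid gadget for the product
(`twoState_series` + `gad_fill`). [folklore] -/
theorem gad_series {WF WG : ℕ × ℕ → ℕ × ℕ → MvPolynomial ι R} {r c hF wF hG wG : ℕ}
    {gF gG : MvPolynomial ι R} (hGF : Gad⟦WF, r, c, hF, wF, gF⟧)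
    (hGG : Gad⟦WG, r, c + wF, hG, wG, gG⟧) (hwF : Even wF) (hwG : Even wG) (h2F : 2 ≤ wF)
    (h2G : 2 ≤ wG) (h1F : 1 ≤ hF) (h1G : 1 ≤ hG) :
    ∃ W : ℕ × ℕ → ℕ × ℕ → MvPolynomial ι R, Gad⟦W, r, c, max hF hG, wF + wG, gF * gG⟧ := by
  obtain ⟨hlabF, hsuppF, hTF⟩ := hGF
  obtain ⟨hlabG, hsuppG, hTG⟩ := hGG
  obtain ⟨kF, hkF⟩ := hwF
  obtain ⟨kG, hkG⟩ := hwG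
  -- the combined weight: the two gadgets and one unit connector edge on the top row
  let W : ℕ × ℕ → ℕ × ℕ → MvPolynomial ι R := fun u v => WF u v + WG u v +
    if (u.1 = r ∧ u.2 + 1 = c + wF ∧ v.1 = r ∧ v.2 = c + wF) ∨
        (v.1 = r ∧ v.2 + 1 = c + wF ∧ u.1 = r ∧ u.2 = c + wF) then 1 else 0
  have hW : ∀ u v, W u v = WF u v + WG u v +
      if (u.1 = r ∧ u.2 + 1 = c + wF ∧ v.1 = r ∧ v.2 = c + wF) ∨
        (v.1 = r ∧ v.2 + 1 = c + wF ∧ u.1 = r ∧ u.2 = c + wF) then 1 else 0 := fun u v => rfl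
  have zF : ∀ u v, u ∉ box⟦r, c, hF, wF⟧ ∨ v ∉ box⟦r, c, hF, wF⟧ → WF u v = 0 := fun u v h => by
    by_contra hne
    obtain ⟨hu, hv, -⟩ := hsuppF u v hne
    rcases h with h | h
    exacts [h hu, h hv]
  have zG : ∀ u v, u ∉ box⟦r, c + wF, hG, wG⟧ ∨ v ∉ box⟦r, c + wF, hG, wG⟧ → WG u v = 0 :=
    fun u v h => by
    by_contra hne
    obtain ⟨hu, hv, -⟩ := hsuppG u v hne
    rcases h with h | h
    exacts [h hu, h hv]
  have hWF : ∀ a ∈ box⟦r, c, hF, wF⟧, ∀ b ∈ box⟦r, c, hF, wF⟧, WF a b = W a b := by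
    intro a ha b hb
    rw [mem_box] at ha hb
    rw [hW, zG a b (Or.inl (by rw [mem_box]; omega)), if_neg (by omega), add_zero, add_zero]
  have hWG : ∀ a ∈ box⟦r, c + wF, hG, wG⟧, ∀ b ∈ box⟦r, c + wF, hG, wG⟧, WG a b = W a b := by
    intro a ha b hb
    rw [mem_box] at ha hb
    rw [hW, zF a b (Or.inl (by rw [mem_box]; omega)), if_neg (by omega), zero_add, add_zero]
  have hdisj : Disjoint box⟦r, c, hF, wF⟧ box⟦r, c + wF, hG, wG⟧ := by
    rw [Finset.disjoint_left]
    intro a ha hb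
    rw [mem_box] at ha hb
    omega
  have hser := twoState_series (twoState_congr hWF hTF) (twoState_congr hWG hTG) hdisj
    (fun x hx y hy hne => by
      rw [mem_box] at hx hy
      rw [hW, zF x y (Or.inr (by rw [mem_box]; omega)), zG x y (Or.inl (by rw [mem_box]; omega)),
        zero_add, zero_add] at hne
      by_cases hcond : (x.1 = r ∧ x.2 + 1 = c + wF ∧ y.1 = r ∧ y.2 = c + wF) ∨
          (y.1 = r ∧ y.2 + 1 = c + wF ∧ x.1 = r ∧ x.2 = c + wF)
      · exact ⟨Prod.ext (by simp only; omega) (by simp only; omega),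
          Prod.ext (by simp only; omega) (by simp only; omega)⟩
      · exact absurd (if_neg hcond) hne)
    (by
      rw [hW, hW, zF _ _ (Or.inr (by rw [mem_box]; omega)), zG _ _ (Or.inl (by rw [mem_box]; omega)),
        zF _ _ (Or.inl (by rw [mem_box]; omega)), zG _ _ (Or.inr (by rw [mem_box]; omega)),
        if_pos (by dsimp only; omega), if_pos (by dsimp only; omega)]
      simp)
  have hlab : ∀ a b, IsLab⟦W a b⟧ := by
    intro a b
    rw [hW]
    refine isLab_add (isLab_add (hlabF a b) (hlabG a b) ?_) (isLab_ite isLab_one isLab_zero) ?_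
    · by_cases ha : a ∈ box⟦r, c, hF, wF⟧
      · rw [mem_box] at ha
        exact Or.inr (zG a b (Or.inl (by rw [mem_box]; omega)))
      · exact Or.inl (zF a b (Or.inl ha))
    · by_cases hcond : (a.1 = r ∧ a.2 + 1 = c + wF ∧ b.1 = r ∧ b.2 = c + wF) ∨
          (b.1 = r ∧ b.2 + 1 = c + wF ∧ a.1 = r ∧ a.2 = c + wF)
      · left
        rcases hcond with h | h
        · rw [zF a b (Or.inr (by rw [mem_box]; omega)), zG a b (Or.inl (by rw [mem_box]; omega)),
            add_zero]
        · rw [zF a b (Or.inl (by rw [mem_box]; omega)), zG a b (Or.inr (by rw [mem_box]; omega)),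
            add_zero]
      · exact Or.inr (if_neg hcond)
  have hsupp : ∀ a b, W a b ≠ 0 → a ∈ box⟦r, c, max hF hG, wF + wG⟧ ∧
      b ∈ box⟦r, c, max hF hG, wF + wG⟧ ∧ Adj⟦a, b⟧ := by
    intro a b hab
    rw [hW] at hab
    by_cases h1 : WF a b = 0
    · by_cases h2 : WG a b = 0
      · rw [h1, h2, zero_add, zero_add] at hab
        by_cases hcond : (a.1 = r ∧ a.2 + 1 = c + wF ∧ b.1 = r ∧ b.2 = c + wF) ∨
            (b.1 = r ∧ b.2 + 1 = c + wF ∧ a.1 = r ∧ a.2 = c + wF)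
        · rw [mem_box, mem_box]
          omega
        · exact absurd (if_neg hcond) hab
      · obtain ⟨ha, hb, hadj⟩ := hsuppG a b h2
        rw [mem_box] at ha hb ⊢
        rw [mem_box]
        exact ⟨by omega, by omega, hadj⟩
    · obtain ⟨ha, hb, hadj⟩ := hsuppF a b h1
      rw [mem_box] at ha hb ⊢
      rw [mem_box]
      exact ⟨by omega, by omega, hadj⟩
  have hτ : ∀ a ∈ box⟦r, c, max hF hG, wF + wG⟧ \ (box⟦r, c, hF, wF⟧ ∪ box⟦r, c + wF, hG, wG⟧),
      (fun v : ℕ × ℕ => (v.1, if (v.2 + c) % 2 = 0 then v.2 + 1 else v.2 - 1)) a ∈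
          box⟦r, c, max hF hG, wF + wG⟧ \ (box⟦r, c, hF, wF⟧ ∪ box⟦r, c + wF, hG, wG⟧) ∧
        (fun v : ℕ × ℕ => (v.1, if (v.2 + c) % 2 = 0 then v.2 + 1 else v.2 - 1)) a ≠ a ∧
        (fun v : ℕ × ℕ => (v.1, if (v.2 + c) % 2 = 0 then v.2 + 1 else v.2 - 1))
          ((fun v : ℕ × ℕ => (v.1, if (v.2 + c) % 2 = 0 then v.2 + 1 else v.2 - 1)) a) = a ∧
        Adj⟦a, (fun v : ℕ × ℕ => (v.1, if (v.2 + c) % 2 = 0 then v.2 + 1 else v.2 - 1)) a⟧ := by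
    intro a ha
    simp only [Finset.mem_sdiff, Finset.mem_union, mem_box] at ha
    refine ⟨?_, ?_, ?_, ?_⟩
    · simp only [Finset.mem_sdiff, Finset.mem_union, mem_box]
      split_ifs <;> omega
    · intro h
      have := congrArg Prod.snd h
      simp only at this
      split_ifs at this <;> omega
    · ext
      · rfl
      · simp only
        split_ifs <;> omega
    · dsimp only
      split_ifs <;> omega
  obtain ⟨W', hlab', hsupp', hT'⟩ := gad_fill (B := box⟦r, c, max hF hG, wF + wG⟧)
    (fun v => (v.1, if (v.2 + c) % 2 = 0 then v.2 + 1 else v.2 - 1)) hlab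
    (fun a b hab => by
      rw [hW] at hab
      by_cases h1 : WF a b = 0
      · by_cases h2 : WG a b = 0
        · rw [h1, h2, zero_add, zero_add] at hab
          by_cases hcond : (a.1 = r ∧ a.2 + 1 = c + wF ∧ b.1 = r ∧ b.2 = c + wF) ∨
              (b.1 = r ∧ b.2 + 1 = c + wF ∧ a.1 = r ∧ a.2 = c + wF)
          · rw [Finset.mem_union, Finset.mem_union, mem_box, mem_box, mem_box, mem_box]
            omega
          · exact absurd (if_neg hcond) hab
        · obtain ⟨ha, hb, hadj⟩ := hsuppG a b h2
          exact ⟨Finset.mem_union_right _ ha, Finset.mem_union_right _ hb, hadj⟩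
      · obtain ⟨ha, hb, hadj⟩ := hsuppF a b h1
        exact ⟨Finset.mem_union_left _ ha, Finset.mem_union_left _ hb, hadj⟩)
    hser (fun v hv => by
      rw [Finset.mem_union, mem_box, mem_box] at hv
      rw [mem_box]
      omega) hτ
  refine ⟨W', hlab', hsupp', ?_⟩
  simpa only [show c + wF + wG - 1 = c + (wF + wG) - 1 by omega] using hT'

end Grid2

end FormulaGridProjection

open Finset FormulaGridProjection in
/-- **Registered sub-goal `stub_formulaGridProjection_seriesGadget`** of `stub_formulaGridProjection`
(crux stmt-ValiantsHypothesis-5066, line `planar-dimer-sign-elimination`): SERIES COMPOSITION of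
grid gadgets computes the product (`FormulaGridProjection.gad_series` with the notation expanded).
[folklore] -/
theorem stub_formulaGridProjection_seriesGadget : ∀ (R : Type) [CommSemiring R] (ι : Type) (WF WG : ℕ × ℕ → ℕ × ℕ → MvPolynomial ι R) (r c hF wF hG wG : ℕ) (gF gG : MvPolynomial ι R), ((∀ a b, ((∃ j, WF a b = MvPolynomial.X j) ∨ ∃ c, WF a b = MvPolynomial.C c)) ∧ (∀ a b, WF a b ≠ 0 → a ∈ (Finset.Ico r (r + hF) ×ˢ Finset.Ico c (c + wF)) ∧ b ∈ (Finset.Ico r (r + hF) ×ˢ Finset.Ico c (c + wF)) ∧ ((Prod.fst a + 1 = Prod.fst b ∧ Prod.snd a = Prod.snd b) ∨ (Prod.fst b + 1 = Prod.fst a ∧ Prod.snd a = Prod.snd b) ∨ (Prod.fst a = Prod.fst b ∧ Prod.snd a + 1 = Prod.snd b) ∨ (Prod.fst a = Prod.fst b ∧ Prod.snd b + 1 = Prod.snd a))) ∧ ((r, c) ∈ (Finset.Ico r (r + hF) ×ˢ Finset.Ico c (c + wF)) ∧ (r, c + wF - 1) ∈ (Finset.Ico r (r + hF) ×ˢ Finset.Ico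 c (c + wF)) ∧ (r, c) ≠ (r, c + wF - 1) ∧ Even (Finset.card (Finset.Ico r (r + hF) ×ˢ Finset.Ico c (c + wF))) ∧ Summit.ValiantsHypothesis.ValiantsHypothesis.Theorems.DivisionGapZeroOneTransfer.FormulaGridProjection.msum (Finset.Ico r (r + hF) ×ˢ Finset.Ico c (c + wF)) WF = gF ∧ Summit.ValiantsHypothesis.ValiantsHypothesis.Theorems.DivisionGapZeroOneTransfer.FormulaGridProjection.msum (Finset.erase (Finset.erase (Finset.Ico r (r + hF) ×ˢ Finset.Ico c (c + wF)) (r, c)) (r, c + wF - 1)) WF = 1)) → ((∀ a b, ((∃ j, WG a b = MvPolynomial.X j) ∨ ∃ c, WG a b = MvPolynomial.C c)) ∧ (∀ a b, WG a b ≠ 0 → a ∈ (Finset.Ico r (r + hG) ×ˢ Finset.Ico (c + wF) ((c + wF) + wG)) ∧ b ∈ (Finset.Ico r (r + hG) ×ˢ Finset.Ico (c + wF) ((c + wF) + wG)) ∧ ((Prod.fst a + 1 = Prod.fst b ∧ Prod.snd a = Prod.snd b) ∨ (Prod.fst b + 1 = Prod.fst a ∧ Prod.snd a = Prod.snd b)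 ∨ (Prod.fst a = Prod.fst b ∧ Prod.snd a + 1 = Prod.snd b) ∨ (Prod.fst a = Prod.fst b ∧ Prod.snd b + 1 = Prod.snd a))) ∧ ((r, (c + wF)) ∈ (Finset.Ico r (r + hG) ×ˢ Finset.Ico (c + wF) ((c + wF) + wG)) ∧ (r, (c + wF) + wG - 1) ∈ (Finset.Ico r (r + hG) ×ˢ Finset.Ico (c + wF) ((c + wF) + wG)) ∧ (r, (c + wF)) ≠ (r, (c + wF) + wG - 1) ∧ Even (Finset.card (Finset.Ico r (r + hG) ×ˢ Finset.Ico (c + wF) ((c + wF) + wG))) ∧ Summit.ValiantsHypothesis.ValiantsHypothesis.Theorems.DivisionGapZeroOneTransfer.FormulaGridProjection.msum (Finset.Ico r (r + hG) ×ˢ Finset.Ico (c + wF) ((c + wF) + wG)) WG = gG ∧ Summit.ValiantsHypothesis.ValiantsHypothesis.Theorems.DivisionGapZeroOneTransfer.FormulaGridProjection.msum (Finset.erase (Finset.erase (Finset.Ico r (r + hG) ×ˢ Finset.Ico (c + wF) ((c + wF) + wG)) (r, (c + wF))) (r, (c + wF) + wG - 1)) WG = 1)) → Even wF → Even wG → 2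 ≤ wF → 2 ≤ wG → 1 ≤ hF → 1 ≤ hG → ∃ W : ℕ × ℕ → ℕ × ℕ → MvPolynomial ι R, ((∀ a b, ((∃ j, W a b = MvPolynomial.X j) ∨ ∃ c, W a b = MvPolynomial.C c)) ∧ (∀ a b, W a b ≠ 0 → a ∈ (Finset.Ico r (r + max hF hG) ×ˢ Finset.Ico c (c + (wF + wG))) ∧ b ∈ (Finset.Ico r (r + max hF hG) ×ˢ Finset.Ico c (c + (wF + wG))) ∧ ((Prod.fst a + 1 = Prod.fst b ∧ Prod.snd a = Prod.snd b) ∨ (Prod.fst b + 1 = Prod.fst a ∧ Prod.snd a = Prod.snd b) ∨ (Prod.fst a = Prod.fst b ∧ Prod.snd a + 1 = Prod.snd b) ∨ (Prod.fst a = Prod.fst b ∧ Prod.snd b + 1 = Prod.snd a))) ∧ ((r, c) ∈ (Finset.Ico r (r + max hF hG) ×ˢ Finset.Ico c (c + (wF + wG))) ∧ (r, c + (wF + wG) - 1) ∈ (Finset.Ico r (r + max hF hG) ×ˢ Finset.Ico c (c + (wF + wG))) ∧ (r, c) ≠ (r, c + (wF + wG) - 1) ∧ Even (Finset.card (Finset.Ico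 r (r + max hF hG) ×ˢ Finset.Ico c (c + (wF + wG)))) ∧ Summit.ValiantsHypothesis.ValiantsHypothesis.Theorems.DivisionGapZeroOneTransfer.FormulaGridProjection.msum (Finset.Ico r (r + max hF hG) ×ˢ Finset.Ico c (c + (wF + wG))) W = (gF * gG) ∧ Summit.ValiantsHypothesis.ValiantsHypothesis.Theorems.DivisionGapZeroOneTransfer.FormulaGridProjection.msum (Finset.erase (Finset.erase (Finset.Ico r (r + max hF hG) ×ˢ Finset.Ico c (c + (wF + wG))) (r, c)) (r, c + (wF + wG) - 1)) W = 1)) :=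
  fun _ _ _ _ _ _ _ _ _ _ _ _ _ hF hG ewF ewG h2F h2G h1F h1G => gad_series hF hG ewF ewG h2F h2G h1F h1G

end Summit.ValiantsHypothesis.ValiantsHypothesis.Theorems.DivisionGapZeroOneTransfer
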